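import Summits.BirchSwinnertonDyer.BirchSwinnertonDyer.Theorems.GenusKolyvaginAtTwoPowDvdShaCardAtTwoRTRegularFrameAtTwo
import Summits.BirchSwinnertonDyer.BirchSwinnertonDyer.Theorems.GenusKolyvaginAtTwoPowDvdShaCardAtTwoRTGrossLevelAtTwo
import Summits.BirchSwinnertonDyer.BirchSwinnertonDyer.Theorems.ByReductionTypeAtTwoRankOneAtTwoOffBigImageOddLocalEngineRegularLemma53Rat
import HarnessLib

/-!
# Route `GenusKolyvaginAtTwo`, crux L⁺_T `PowDvdShaCardAtTwoPosT` (stmt-BirchSwinnertonDyer-23379), road (E4)⁺ (= LINE 18's road (E4) ported to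
# `Δ > 0`), stub X-ORTH⁺ — THE REGULAR FRAME OF THE ADAPTED LIFT AT A TRANSPOSITION-DEEP KOLYVAGIN PLACE, SIGN-FREE

Seat `bsd-line-gk2-p2` g22 (PROVER seat 2/3, cell `bsd-f1-sign2`), `--supports stmt-BirchSwinnertonDyer-23379` (helper; closes nothing).
THEOREMS ONLY (no definition, no named fact, no `sorry`).  BSD is NOT proved by any of this; neither is L⁺_T nor any stub.

WHY (memo `Cruxes/KolyvaginExactAtTwoPosDiscT/RESTATEMENT-R9L-posdisc-lower-gk2p2.md`).  Road (E4) closed the `Δ < 0` lower half L_T (p744020).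
Its X-ORTH socket touches `Δ < 0` / Gross's `FrobEqFrobInfty` at exactly ONE lemma: `…RTRegularFrameAtTwo.exists_regular_frame_liftAutPlace` —
at a deep inert Kolyvagin place `λ`, the adapted lift `τ̃_*` (`τ̃ = liftAutPlace τ hfix`) is a REGULAR involution of `E[2^M](K̄)`
(`E[2^M] = ℤQ₀ ⊕ ℤ·τ̃_*Q₀` freely over `ℤ/2^M`), because `τ̃_*` is a complex conjugation `c₀` transported and `c₀` is regular on `Δ < 0`.
On `Δ > 0` no complex conjugation is regular (`…PosTComplexConjugationNotRegular`); the regular Čebotarev class there is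
«`Frob_ℓ` MOVES A POINT OF `E[2]`» (a transposition of `E[2] ∖ 0`; LINE 16_T's regular primes, gk2-p4 g23's Part C p754753).  THIS FILE proves the
same regular frame from that TRANSPOSITION hypothesis, for either sign of `Δ`:

* `frob_involutive_and_moves_twoTorsion_of_transposition` — at a Zhang–Kolyvagin prime `ℓ` of index `≥ M ≥ 1` whose Frobenius (at SOME prime
  above `ℓ`) moves a point of `E[2]`, EVERY arithmetic Frobenius `h₀` at EVERY prime `𝔓' ∣ ℓ` of `\bar ℤ` is an involution of `E[2^M](ℚ̄)`
  (`KolyvaginDepthDoor.frob_smul_smul_eq_self_of_pow_dvd`: `tr = a_ℓ ≡ 0`, `det = ℓ ≡ −1 (mod 2^M)`) and moves a point of `E[2]` (conjugate the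
  primes, inertia is trivial on `E[2]`) — the transport step of gk2-p5 g22's `…RTGrossLevelAtTwo`, verbatim, minus its `Δ < 0` half;
* `torsionMap_liftAutPlace_eq_transport_frob` — `τ̃_* (e_K P) = e_K (h₀ • P)` for `h₀` any arithmetic Frobenius at the prime `𝔓₀ ∩ \bar ℤ` below the
  prime `𝔓₀` of `\bar ℤ_K` cut out by `K̄ → \bar K_λ` (gk2-p3 g23's `torsionMap_liftAutPlace_eq_transport_conj` with the Gross step removed: the
  transport `γ` of `τ̃` and `h₀` differ by an element of `Γ_K` in the decomposition group of `𝔓₀`, which FIXES `E[2^M](K̄)` — Jet brick C);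
* **`exists_regular_frame_liftAutPlace_of_transposition`** — the regular frame: `∃ Q₀`, `2^M Q₀ = 0`, `E[2^M](K̄) = {aQ₀ + b·τ̃_*Q₀}`,
  `aQ₀ + b·τ̃_*Q₀ = 0 ⟹ 2^M ∣ a, b`, `τ̃_*² = 1` — SAME conclusion as `exists_regular_frame_liftAutPlace`, hypotheses `Δ < 0 ∧ FrobEqFrobInfty W K (2^M) ℓ`
  replaced by the transposition clause (the generator is crux 23716's engine lemma `Engine.exists_regular_generator_of_smul_twoTorsion_ne`);
* `transposition_of_frobEqFrobInfty_of_Δ_neg` — on `Δ < 0` Gross's (3.2) at level `2` GIVES the transposition clause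
  (`GenusKolySign.exists_twoTorsion_frob_smul_ne_of_frobEqFrobInfty_of_Δ_neg`), so every downstream twin stated with it subsumes its `Δ < 0` original;
  `exists_regular_frame_liftAutPlace_of_frobEqFrobInfty_two` — the `Δ < 0` frame from the LEVEL-2 Gross condition only (no `ρ_{E,2^M}` onto needed,
  unlike the level-lifting `frobEqFrobInfty_two_pow_of_frobEqFrobInfty_two`).
Downstream (this seat, next files): the transposition twins of `…RTCrossSignLocalVanishing` §3, `…RTCrossPairVanishing` §3, `…RTCrossPairTerm`,
`…RTCrossPairProvenance(Socket)` ⟹ X-ORTH∃ of (E4)⁺ sign-free.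

References: [GrossLMS1991] §3 (3.1)–(3.3), §4; [McCallumLMS1991] §4 (p. 299), §5 Lemma 5.3; [Kolyvagin1991MathAnn] Thm. 2.1; [Jetchev2008] §3.2 (2);
[SilvermanAEC2009] VII.4.1, C.21 Remark 21.3.
-/

set_option autoImplicit false

noncomputable section

open scoped Classical
open Function Field NumberField IsDedekindDomain WeierstrassCurve Rat.HeightOneSpectrum
open Literature.NumberTheory.EllipticCurves Literature.NumberTheory.GaloisRepresentations
open Literature.NumberTheory.Automorphic
open Summit.BirchSwinnertonDyer.Rank1Residual.JET.GlobalDuality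
open Summit.BirchSwinnertonDyer.Rank1Residual.X11b.Three.Koly.Method2
open Summit.BirchSwinnertonDyer.Rank1Residual.X11b.Three.Koly.Method2.KolyLocal
open Summit.BirchSwinnertonDyer.BirchSwinnertonDyer.Theorems.KolyvaginDepthDoor (frob_smul_smul_eq_self_of_pow_dvd)
open Summit.BirchSwinnertonDyer.BirchSwinnertonDyer.Theorems.OffBigImageOddLocalAtTwo.Engine (exists_regular_generator_of_smul_twoTorsion_ne)

-- the Theorems namespace of this sub repeats the summit name by design (D-0017 nested layout)
set_option linter.dupNamespace false

namespace Summit.BirchSwinnertonDyer.BirchSwinnertonDyer.Theorems.GenusExact.PlusDescent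

variable (W : WeierstrassCurve ℚ) (K : Type) [Field K] [NumberField K] [W.IsElliptic] [W.IsGloballyMinimal]

/-! ## §1 Transport over `ℚ`: every Frobenius above a transposition-deep prime is an involution of `E[2^M]` moving a point of `E[2]` -/

/-- **Every Frobenius above a transposition-deep Zhang–Kolyvagin prime is a regular involution of `E[2^M]`.**  `ℓ` a Zhang–Kolyvagin prime at `2`
(for some Heegner field `K`: `ℓ ∤ N_E`, `ℓ ≠ 2`, …) of index `M(ℓ) ≥ M ≥ 1` such that SOME arithmetic Frobenius at SOME prime of `\bar ℤ` above `ℓ`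
moves a point of `E[2]`.  Then for EVERY prime `𝔓' ∣ ℓ` of `\bar ℤ` and EVERY arithmetic Frobenius `h₀` at `𝔓'`: `h₀² = 1` on `E[2^M](ℚ̄)`
(`2^M ∣ a_ℓ`, `2^M ∣ ℓ + 1`: trace `0`, determinant `−1`) and `h₀` moves a point of `E[2]` (the primes above `ℓ` are `Γ_ℚ`-conjugate and inertia
acts trivially on `E[2]`, `ℓ` odd of good reduction).  (Proof adapted from `GrossLevelAtTwo.frobEqFrobInfty_two_pow_of_frobEqFrobInfty_two`,
gk2-p5 g22: its transport step.) [cite: GrossLMS1991, §3 (3.1)–(3.3)] [cite: SilvermanAEC2009, VII.4.1, C.21 Remark 21.3] -/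
theorem frob_involutive_and_moves_twoTorsion_of_transposition {M ℓ : ℕ} (hM : 1 ≤ M)
    (hℓ : Zhang2014.IsKolyvaginPrime (W.conductorNorm ℤ) W K 2 ℓ) (hk : M ≤ Zhang2014.kolyvaginIndex W 2 ℓ)
    (hR : ∃ (v : HeightOneSpectrum (𝓞 ℚ)) (𝔓 : Ideal (absIntegers (𝓞 ℚ) ℚ)) (h : absoluteGaloisGroup ℚ),
      (ℓ : 𝓞 ℚ) ∈ v.asIdeal ∧ 𝔓 ∈ v.primesAbove ∧ IsArithFrobAt (𝓞 ℚ) h 𝔓 ∧ ∃ u : geomTorsion W 2, h • u ≠ u)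
    {v₁ : HeightOneSpectrum (𝓞 ℚ)} (hℓv₁ : (ℓ : 𝓞 ℚ) ∈ v₁.asIdeal)
    {𝔓' : Ideal (absIntegers (𝓞 ℚ) ℚ)} (h𝔓' : 𝔓' ∈ v₁.primesAbove)
    {h₀ : absoluteGaloisGroup ℚ} (hh₀ : IsArithFrobAt (𝓞 ℚ) h₀ 𝔓') :
    (∀ X : geomTorsion W ((2 ^ M : ℕ) : ℤ), h₀ • h₀ • X = X) ∧ ∃ u : geomTorsion W 2, h₀ • u ≠ u := by
  haveI : Fact (Nat.Prime 2) := ⟨Nat.prime_two⟩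
  obtain ⟨n, rfl⟩ : ∃ n, M = n + 1 := ⟨M - 1, by omega⟩
  have hℓp : ℓ.Prime := hℓ.1
  have hℓ2 : ℓ ≠ 2 := hℓ.2.2.2.1
  have hdvdM := (Zhang2014.le_kolyvaginIndex_iff (W := W) (p := 2)).mp hk
  have hgoodv : W.HasGoodReductionAt v₁ :=
    LocalFrob.hasGoodReductionAt_rat_of_not_dvd_conductorNorm W hℓp hℓ.2.1 v₁ hℓv₁
  have hv₁ℓ : (primesEquiv v₁ : ℕ) = ℓ := primesEquiv_eq_of_natCast_mem hℓp hℓv₁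
  have h2v : ((2 : ℤ) : 𝓞 ℚ) ∉ v₁.asIdeal := by
    intro h2
    have h2' : ((2 : ℕ) : 𝓞 ℚ) ∈ v₁.asIdeal := by exact_mod_cast h2
    exact hℓ2 (hv₁ℓ.symm.trans (primesEquiv_eq_of_natCast_mem Nat.prime_two h2'))
  refine ⟨fun X ↦ ?_, ?_⟩
  · -- involution: trace `a_ℓ ≡ 0`, determinant `ℓ ≡ −1 (mod 2^{n+1})`
    have haℓ : ((2 : ℤ) ^ (n + 1)) ∣ W.frobeniusTraceAt v₁ := by
      rw [frobeniusTraceAt_eq_frobeniusTrace W v₁, show ((primesEquiv v₁ : ℕ)) = ℓ from hv₁ℓ]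
      exact_mod_cast hdvdM.2
    apply Subtype.ext
    exact frob_smul_smul_eq_self_of_pow_dvd W n hℓp hℓ2 hℓv₁ hgoodv h𝔓' hh₀ hdvdM.1 haℓ X.2
  · -- `h₀` moves a point of `E[2]`: transport of the transposition hypothesis along `Γ_ℚ`, inertia trivial on `E[2]`
    obtain ⟨v', 𝔓'', h'', hv', h𝔓'', hfr'', P, hP⟩ := hR
    have hvv : v' = v₁ := by
      have h1 : (primesEquiv v' : ℕ) = ℓ := primesEquiv_eq_of_natCast_mem hℓp hv'
      exact primesEquiv.injective (Subtype.ext (h1.trans hv₁ℓ.symm))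
    subst hvv
    obtain ⟨g, hg⟩ := HeightOneSpectrum.exists_smul_eq_of_mem_primesAbove_holds h𝔓' h𝔓''
    have hσ₁ : IsArithFrobAt (𝓞 ℚ) (g * h₀ * g⁻¹) 𝔓'' := hg ▸ hh₀.conj g
    have hI := hfr''.mul_inv_mem_inertia hσ₁
    have hσσ₁ : ∀ Q : geomTorsion W 2, h'' • Q = (g * h₀ * g⁻¹) • Q := fun Q ↦ by
      have h' := W.smul_geomTorsion_eq_of_mem_inertia hgoodv h2v h𝔓'' hI ((g * h₀ * g⁻¹) • Q)
      rwa [mul_smul, inv_smul_smul] at h'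
    have hP' : (g * h₀ * g⁻¹) • P ≠ P := by rw [← hσσ₁]; exact hP
    refine ⟨g⁻¹ • P, fun heq ↦ hP' ?_⟩
    rw [mul_smul, mul_smul, heq, smul_inv_smul]

/-! ## §2 Over `K`: the adapted lift acts on `E[2^M](K̄)` as the Frobenius below the completion prime, transported -/

/-- **The adapted lift acts on `E[2^M](K̄)` as a Frobenius transported from `E[2^M](ℚ̄)`.**  `K` imaginary quadratic, `τ ≠ 1`; `ℓ` a Zhang–Kolyvagin
prime at `2` with `M ≤ M(ℓ)`, `λ ∋ ℓ`, `τ • λ = λ`; `𝔓₀` the prime of `\bar ℤ_K` cut out by `K̄ → \bar K_λ` (`adicCompletionPrime K λ`) and `h₀` ANY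
arithmetic Frobenius at `𝔓₀ ∩ \bar ℤ`.  Then `τ̃_* (e_K P) = e_K (h₀ • P)` for all `P ∈ E[2^M](ℚ̄)`, where `τ̃ = liftAutPlace τ hfix` and
`e_K = RatClosure.torsionEquiv`: the transport `γ ∈ Γ_ℚ` of `τ̃` lies in the decomposition group of `𝔓₀ ∩ \bar ℤ`, `h₀⁻¹γ` fixes `K` (both lift `τ`,
`ℓ` being inert) and stabilises `𝔓₀`, hence fixes `E[2^M](K̄)` (Jet brick C: the decomposition group of a Zhang–Kolyvagin prime of index `≥ M`
fixes `E[2^M]`).  (Proof adapted from `torsionMap_liftAutPlace_eq_transport_conj`, gk2-p3 g23, with the Gross step removed.)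
[cite: GrossLMS1991, §4] [cite: Jetchev2008, §3.2 (2)] [cite: McCallumLMS1991, §4 Prop. 4.4 (proof)] -/
theorem torsionMap_liftAutPlace_eq_transport_frob (hK : IsImaginaryQuadratic K) {M ℓ : ℕ}
    (hℓ : Zhang2014.IsKolyvaginPrime (W.conductorNorm ℤ) W K 2 ℓ) (hk : M ≤ Zhang2014.kolyvaginIndex W 2 ℓ)
    (w : HeightOneSpectrum (𝓞 K)) (hw : (ℓ : 𝓞 K) ∈ w.asIdeal)
    {τ : K ≃ₐ[ℚ] K} (hτ1 : τ ≠ 1) (hfix : τ • w = w)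
    {h₀ : absoluteGaloisGroup ℚ} (hh₀ : IsArithFrobAt (𝓞 ℚ) h₀ ((adicCompletionPrime K w).comap (absIntegersMap ℚ K))) :
    ∀ P : geomTorsion W ((2 ^ M : ℕ) : ℤ),
      (isLiftOfAut_liftAutPlace τ hfix).torsionMap W ((2 ^ M : ℕ) : ℤ) (RatClosure.torsionEquiv (K := K) W ((2 ^ M : ℕ) : ℤ) P) =
        RatClosure.torsionEquiv (K := K) W ((2 ^ M : ℕ) : ℤ) (h₀ • P) := by
  haveI : Fact (Nat.Prime 2) := ⟨Nat.prime_two⟩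
  have hℓp : ℓ.Prime := hℓ.1
  have hℓP : (Ideal.span {(ℓ : 𝓞 K)}).IsPrime := hℓ.2.2.2.2.1
  set n : ℤ := ((2 ^ M : ℕ) : ℤ) with hn
  -- the place `v₁` of `ℚ` below `w` and the prime `𝔓' = 𝔓₀ ∩ \bar ℤ`
  set v₁ : HeightOneSpectrum (𝓞 ℚ) := w.under (𝓞 ℚ) with hv₁
  have hwv₁ : w.asIdeal.under (𝓞 ℚ) = v₁.asIdeal := rfl
  have hℓv₁ : (ℓ : 𝓞 ℚ) ∈ v₁.asIdeal := by
    rw [← hwv₁, Ideal.under_def, Ideal.mem_comap, map_natCast]; exact hw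
  set 𝔓 := adicCompletionPrime K w with h𝔓def
  have h𝔓 : 𝔓 ∈ w.primesAbove := adicCompletionPrime_mem_primesAbove K w
  set 𝔓' := 𝔓.comap (absIntegersMap ℚ K) with h𝔓'def
  have h𝔓' : 𝔓' ∈ v₁.primesAbove := comap_absIntegersMap_mem_primesAbove hwv₁ h𝔓
  haveI : 𝔓'.IsPrime := h𝔓'.1
  -- the transport `γ` of the adapted lift
  obtain ⟨γ, hγ, hγD⟩ := exists_transport_liftAutPlace_mem_decompositionSubgroup K τ hfix
  have ht := isLiftOfAut_liftAutPlace τ hfix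
  -- `g₀ = h₀⁻¹ γ` fixes `K` and stabilises `𝔓₀`, hence fixes `E[2^M](K̄)`
  have hlift : IsLiftOfAut τ (absGaloisTransport (K := ℚ) (L := K) h₀).toRingEquiv :=
    isLiftOfAut_absGaloisTransport_of_isArithFrobAt K hK hτ1 hℓp hℓP hw h𝔓 hℓv₁ h𝔓' hh₀
  set g₀ : absoluteGaloisGroup ℚ := h₀⁻¹ * γ with hg₀
  have hg₀K : g₀ ∈ Set.range (absGaloisRestrict ℚ K) := by
    rw [mem_range_absGaloisRestrict_iff]
    intro x
    rw [hg₀, map_mul, map_inv, AlgEquiv.mul_apply, ← hγ, ht x]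
    have hx : absGaloisTransport (K := ℚ) (L := K) h₀ (algebraMap K (AlgebraicClosure K) x) =
        algebraMap K (AlgebraicClosure K) (τ x) := hlift x
    rw [← hx, ← AlgEquiv.mul_apply, inv_mul_cancel, AlgEquiv.one_apply]
  obtain ⟨g₁, hg₁⟩ := hg₀K
  have hg₁D : g₁ ∈ 𝔓.decompositionSubgroup (absoluteGaloisGroup K) := by
    rw [← comap_decompositionSubgroup_comap_absIntegersMap ℚ K 𝔓, Subgroup.mem_comap]
    change absGaloisRestrict ℚ K g₁ ∈ 𝔓'.decompositionSubgroup (absoluteGaloisGroup ℚ)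
    rw [hg₁, hg₀]
    exact Subgroup.mul_mem _ (Subgroup.inv_mem _ hh₀.mem_stabilizer) hγD
  have hg₀P : ∀ P : geomTorsion W n, g₀ • P = P := fun P => by
    apply (RatClosure.torsionEquiv (K := K) W n).injective
    rw [← hg₁, RatClosure.torsionEquiv_smul,
      smul_torsion_eq_self_of_mem_decompositionSubgroup W K hK hℓ hk w hw h𝔓 hg₁D]
  have hγP : ∀ P : geomTorsion W n, γ • P = h₀ • P := fun P => by
    have e : γ = h₀ * g₀ := by rw [hg₀, mul_inv_cancel_left]
    rw [e, mul_smul, hg₀P]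
  intro P
  rw [← hγP, RatClosure.torsionEquiv_smul_of_lift W ht γ hγ n P]

/-! ## §3 The regular frame of the adapted lift at a transposition-deep place -/

/-- **THE REGULAR FRAME OF THE ADAPTED LIFT AT A TRANSPOSITION-DEEP KOLYVAGIN PLACE, sign-free** (the hypotheses `hspan`, `hfree`, `htor`, `ht` of
`…RTLocalEigenDuality` / `…RTInvariantLostBit` / `…RTCrossSignLocalVanishing` for `T = E[2^M](K̄)`, `t = τ̃_*`).  `K` imaginary quadratic, `τ ≠ 1`;
`E/ℚ` globally minimal (ANY sign of `Δ`); `ℓ` a Zhang–Kolyvagin prime at `2` with `1 ≤ M ≤ M(ℓ)` whose Frobenius moves a point of `E[2]`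
(transposition type); `λ ∋ ℓ`, `τ • λ = λ`.  Then there is `Q₀ ∈ E[2^M](K̄)` with `2^M Q₀ = 0`, `E[2^M](K̄) = {aQ₀ + b·τ̃_*Q₀}`,
`aQ₀ + b·τ̃_*Q₀ = 0 ⟹ 2^M ∣ a ∧ 2^M ∣ b`, and `τ̃_*² = 1` on `E[2^M](K̄)` — `E[2^M]` is free of rank one over `ℤ/2^M[τ̃_*]`.  SAME conclusion as
`exists_regular_frame_liftAutPlace` (gk2-p3 g23, `Δ < 0`, Gross class); here `τ̃_*` is a Frobenius `h₀` transported (§2), `h₀` is an involution moving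
a point of `E[2]` (§1), and the free basis `P, h₀P` is crux 23716's engine lemma `Engine.exists_regular_generator_of_smul_twoTorsion_ne`.
[cite: GrossLMS1991, §3 (3.3), §4] [cite: McCallumLMS1991, §5 Lemma 5.3] [cite: Kolyvagin1991MathAnn, Thm. 2.1] -/
theorem exists_regular_frame_liftAutPlace_of_transposition (hK : IsImaginaryQuadratic K) {M ℓ : ℕ} (hM : 1 ≤ M)
    (hℓ : Zhang2014.IsKolyvaginPrime (W.conductorNorm ℤ) W K 2 ℓ) (hk : M ≤ Zhang2014.kolyvaginIndex W 2 ℓ)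
    (hR : ∃ (v : HeightOneSpectrum (𝓞 ℚ)) (𝔓 : Ideal (absIntegers (𝓞 ℚ) ℚ)) (h : absoluteGaloisGroup ℚ),
      (ℓ : 𝓞 ℚ) ∈ v.asIdeal ∧ 𝔓 ∈ v.primesAbove ∧ IsArithFrobAt (𝓞 ℚ) h 𝔓 ∧ ∃ u : geomTorsion W 2, h • u ≠ u)
    (w : HeightOneSpectrum (𝓞 K)) (hw : (ℓ : 𝓞 K) ∈ w.asIdeal)
    {τ : K ≃ₐ[ℚ] K} (hτ1 : τ ≠ 1) (hfix : τ • w = w) :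
    ∃ Q₀ : geomTorsion (W.baseChange K) ((2 ^ M : ℕ) : ℤ),
      (2 ^ M : ℤ) • Q₀ = 0 ∧
      (∀ Q : geomTorsion (W.baseChange K) ((2 ^ M : ℕ) : ℤ), ∃ a b : ℤ,
        Q = a • Q₀ + b • (isLiftOfAut_liftAutPlace τ hfix).torsionMap W ((2 ^ M : ℕ) : ℤ) Q₀) ∧
      (∀ a b : ℤ, a • Q₀ + b • (isLiftOfAut_liftAutPlace τ hfix).torsionMap W ((2 ^ M : ℕ) : ℤ) Q₀ = 0 →
        (2 ^ M : ℤ) ∣ a ∧ (2 ^ M : ℤ) ∣ b) ∧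
      (∀ Q : geomTorsion (W.baseChange K) ((2 ^ M : ℕ) : ℤ),
        (isLiftOfAut_liftAutPlace τ hfix).torsionMap W ((2 ^ M : ℕ) : ℤ)
          ((isLiftOfAut_liftAutPlace τ hfix).torsionMap W ((2 ^ M : ℕ) : ℤ) Q) = Q) := by
  haveI : Fact (Nat.Prime 2) := ⟨Nat.prime_two⟩
  have hℓp : ℓ.Prime := hℓ.1
  set n : ℤ := ((2 ^ M : ℕ) : ℤ) with hn
  set t := (isLiftOfAut_liftAutPlace τ hfix).torsionMap W n with htdef
  set eK := RatClosure.torsionEquiv (K := K) W n with heK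
  -- the place of `ℚ` below `λ` and the prime `𝔓₀ ∩ \bar ℤ`
  have hwv₁ : w.asIdeal.under (𝓞 ℚ) = (w.under (𝓞 ℚ)).asIdeal := rfl
  have hℓv₁ : (ℓ : 𝓞 ℚ) ∈ (w.under (𝓞 ℚ)).asIdeal := by
    rw [← hwv₁, Ideal.under_def, Ideal.mem_comap, map_natCast]; exact hw
  have h𝔓' : (adicCompletionPrime K w).comap (absIntegersMap ℚ K) ∈ (w.under (𝓞 ℚ)).primesAbove :=
    comap_absIntegersMap_mem_primesAbove hwv₁ (adicCompletionPrime_mem_primesAbove K w)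
  -- a Frobenius `h₀` there: an involution of `E[2^M]` moving a point of `E[2]` (§1), and `τ̃_* = h₀` transported (§2)
  obtain ⟨h₀, hh₀⟩ := HeightOneSpectrum.exists_isArithFrobAt_of_mem_primesAbove_holds h𝔓'
  obtain ⟨hinv, hmv⟩ := frob_involutive_and_moves_twoTorsion_of_transposition W K hM hℓ hk hR hℓv₁ h𝔓' hh₀
  have ht : ∀ P : geomTorsion W n, t (eK P) = eK (h₀ • P) :=
    torsionMap_liftAutPlace_eq_transport_frob W K hK hℓ hk w hw hτ1 hfix hh₀
  -- the regular generator of `E[2^M](ℚ̄)` for `h₀`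
  obtain ⟨P, hPtor, hgen, hfree⟩ := exists_regular_generator_of_smul_twoTorsion_ne W h₀ hmv hM
  have htP : t (eK P) = eK (h₀ • P) := ht P
  refine ⟨eK P, ?_, fun Q ↦ ?_, fun a b hab ↦ ?_, fun Q ↦ ?_⟩
  · -- torsion
    rw [← map_zsmul, hPtor, map_zero]
  · -- generation, transported
    obtain ⟨a, b, hab⟩ := hgen (eK.symm Q)
    refine ⟨a, b, ?_⟩
    rw [htP, ← map_zsmul, ← map_zsmul, ← map_add, ← hab, AddEquiv.apply_symm_apply]
  · -- freeness, transported
    rw [htP, ← map_zsmul, ← map_zsmul, ← map_add, AddEquiv.map_eq_zero_iff] at hab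
    exact hfree a b hab
  · -- involutivity: `τ̃_*² = h₀²` transported `= 1`
    obtain ⟨P', rfl⟩ := eK.surjective Q
    rw [ht P', ht (h₀ • P'), hinv P']

/-! ## §4 Consistency: on `Δ < 0` Gross's class is of transposition type -/

omit [W.IsGloballyMinimal] in
/-- **On `Δ < 0`, Gross's condition (3.2) at level `2` gives the transposition clause**: at a prime with `Frob(ℓ) = Frob(∞)` on `K(E[2])` the
Frobenius moves a point of `E[2]` (a complex conjugation swaps the two non-real `2`-torsion points).  Hence every theorem of road (E4)⁺ stated with the
transposition clause specialises to its `Δ < 0` original. (= `GenusKolySign.exists_twoTorsion_frob_smul_ne_of_frobEqFrobInfty_of_Δ_neg`, gk2-p5, reshaped.)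
[cite: GrossLMS1991, §3 (3.2)] [cite: SilvermanAEC2009, III.1] -/
theorem transposition_of_frobEqFrobInfty_of_Δ_neg (hΔ : W.Δ < 0) {ℓ : ℕ} (hF : FrobEqFrobInfty W K 2 ℓ) :
    ∃ (v : HeightOneSpectrum (𝓞 ℚ)) (𝔓 : Ideal (absIntegers (𝓞 ℚ) ℚ)) (h : absoluteGaloisGroup ℚ),
      (ℓ : 𝓞 ℚ) ∈ v.asIdeal ∧ 𝔓 ∈ v.primesAbove ∧ IsArithFrobAt (𝓞 ℚ) h 𝔓 ∧ ∃ u : geomTorsion W 2, h • u ≠ u := by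
  obtain ⟨v, 𝔓, h, ⟨hv, h𝔓, hfr⟩, P, hP⟩ := GenusKolySign.exists_twoTorsion_frob_smul_ne_of_frobEqFrobInfty_of_Δ_neg W hΔ hF
  exact ⟨v, 𝔓, h, hv, h𝔓, hfr, P, hP⟩

omit [W.IsElliptic] [W.IsGloballyMinimal] in
/-- Gross's condition at level `2^M` (`M ≥ 1`) implies it at level `2` (`E[2] ⊆ E[2^M]`). [cite: GrossLMS1991, §3 (3.2)] -/
theorem frobEqFrobInfty_two_of_two_pow {M ℓ : ℕ} (hM : 1 ≤ M) (hF : FrobEqFrobInfty W K (2 ^ M) ℓ) : FrobEqFrobInfty W K 2 ℓ := by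
  obtain ⟨v, 𝔓, h, c₀, hv, h𝔓, hfr, hc₀, hP, hK⟩ := hF
  refine ⟨v, 𝔓, h, c₀, hv, h𝔓, hfr, hc₀, fun P ↦ ?_, hK⟩
  have hdvd : ((2 : ℕ) : ℤ) ∣ ((2 ^ M : ℕ) : ℤ) := by
    obtain ⟨m, rfl⟩ : ∃ m, M = m + 1 := ⟨M - 1, by omega⟩
    exact ⟨((2 ^ m : ℕ) : ℤ), by push_cast; ring⟩
  have hPM : (P : geomPoints W) ∈ geomTorsion W ((2 ^ M : ℕ) : ℤ) := geomTorsion_le_of_dvd W hdvd P.2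
  have h1 := congrArg Subtype.val (hP ⟨P, hPM⟩)
  exact Subtype.ext h1

/-- **The `Δ < 0` regular frame from the LEVEL-2 Gross condition** (corollary of §3 + §4): as `exists_regular_frame_liftAutPlace` but with
`FrobEqFrobInfty W K 2 ℓ` in place of `FrobEqFrobInfty W K (2^M) ℓ`. [cite: GrossLMS1991, §3 (3.2), §4] [cite: McCallumLMS1991, §5 Lemma 5.3] -/
theorem exists_regular_frame_liftAutPlace_of_frobEqFrobInfty_two (hK : IsImaginaryQuadratic K) (hΔ : W.Δ < 0) {M ℓ : ℕ} (hM : 1 ≤ M)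
    (hℓ : Zhang2014.IsKolyvaginPrime (W.conductorNorm ℤ) W K 2 ℓ) (hk : M ≤ Zhang2014.kolyvaginIndex W 2 ℓ)
    (hF : FrobEqFrobInfty W K 2 ℓ) (w : HeightOneSpectrum (𝓞 K)) (hw : (ℓ : 𝓞 K) ∈ w.asIdeal)
    {τ : K ≃ₐ[ℚ] K} (hτ1 : τ ≠ 1) (hfix : τ • w = w) :
    ∃ Q₀ : geomTorsion (W.baseChange K) ((2 ^ M : ℕ) : ℤ),
      (2 ^ M : ℤ) • Q₀ = 0 ∧
      (∀ Q : geomTorsion (W.baseChange K) ((2 ^ M : ℕ) : ℤ), ∃ a b : ℤ,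
        Q = a • Q₀ + b • (isLiftOfAut_liftAutPlace τ hfix).torsionMap W ((2 ^ M : ℕ) : ℤ) Q₀) ∧
      (∀ a b : ℤ, a • Q₀ + b • (isLiftOfAut_liftAutPlace τ hfix).torsionMap W ((2 ^ M : ℕ) : ℤ) Q₀ = 0 →
        (2 ^ M : ℤ) ∣ a ∧ (2 ^ M : ℤ) ∣ b) ∧
      (∀ Q : geomTorsion (W.baseChange K) ((2 ^ M : ℕ) : ℤ),
        (isLiftOfAut_liftAutPlace τ hfix).torsionMap W ((2 ^ M : ℕ) : ℤ)
          ((isLiftOfAut_liftAutPlace τ hfix).torsionMap W ((2 ^ M : ℕ) : ℤ) Q) = Q) :=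
  exists_regular_frame_liftAutPlace_of_transposition W K hK hM hℓ hk (transposition_of_frobEqFrobInfty_of_Δ_neg W K hΔ hF) w hw hτ1 hfix

end Summit.BirchSwinnertonDyer.BirchSwinnertonDyer.Theorems.GenusExact.PlusDescent

end
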